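import Literature.NumberTheory.EllipticCurves.NonsingularReductionEmbedding
import Literature.NumberTheory.EllipticCurves.CMPointsIdentityComponentLabel
import Mathlib.NumberTheory.RamificationInertia.Valuation
import HarnessLib

/-!
# Orbit counting in a quotient and DESCENT of `E₀` along a map of number fields — the two generic lemmas behind the auxiliary-norm
# derivation of Gross's E′-label (cell `bsd-stepL`, seat `bsd-stepL-tam3-p1` g18, LINE OWNER of crux 19109 `EulerHalvesAtThree`;
# `--supports stmt-BirchSwinnertonDyer-19109 --as helper`; route-free, curve-free except §1)

* §0 (abstract algebra, Mathlib only): (A1) `exists_sum_eq_card_nsmul` — a right-`D`-invariant function on a finite group sums into `#D • A`;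
  (A1″) `exists_sum_range_eq_card_stabilizer_nsmul_of_invariant` — for `σ ^ n = 1` acting on `X` and `c : G → A` invariant under LEFT
  multiplication by the stabiliser of `x` in `⟨σ⟩`: `∑_{i<n} c (σ^i) ∈ #Stab_{⟨σ⟩}(x) • A` (the decomposition group of a place in a cyclic
  ring class layer); (A2) `nsmul_ordCompl_eq_zero_of_smul_eq_card_nsmul` — in an abelian group killed by `c`: `a • x = D • t`, `a` prime to
  `p`, `p^e ∣ D`, `p^e ∣ c` ⟹ `(c ∕ p^e) • x = 0` (Bezout).
* §1 `hasNonsingularReduction_of_forall_place_map` — for `W/ℚ` with integer coefficients and a `ℚ`-algebra map `f : L₁ → L₂` of number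
  fields: nonsingular reduction of `f P` at EVERY place of `L₂` over `q` gives nonsingular reduction of `P` at every place of `L₁` over `q`
  (going up for `𝓞 L₂ ∕ 𝓞 L₁`, Mathlib `valuation_liesOver`, and the tree's coordinate transport `hasNonsingularReduction_some_iff_of_ringHom`).
Consumed by `…ShimuraAuxNormE0Prime` (the E′-label at a K-split carrier). HONEST FRAMING: THEOREMS ONLY; nothing about any curve of the
ladder is asserted; no item closes; BSD is proved for no curve (T7).
-- §0 (A1) adapted verbatim from Summits/…/Cruxes/EulerHalfNotRamNoInertSetAtFive/Lines/aux_norm_receptacle.lean (bsd-idea-9 g8).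
References (locators only): [cite: NeukirchANT1999, Ch. II (8.1)–(8.2)] [cite: SilvermanAEC2009, VII §2, Prop. 2.1].
presearch: n/a (elementary algebra and plumbing over tree∕Mathlib theorems). Axioms: `propext`, `Classical.choice`, `Quot.sound`.
-/

set_option autoImplicit false
set_option linter.dupNamespace false

noncomputable section

open scoped Classical NumberField Pointwise

namespace Summit.BirchSwinnertonDyer.BirchSwinnertonDyer.Theorems.ShimuraWalk

open WeierstrassCurve IsDedekindDomain NumberField Field Literature.NumberTheory.EllipticCurves

/-! ### §0 Abstract algebra -/

/-- (A1) A function on a finite group which is invariant under right translation by a subgroup `D` has total sum divisible by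
`#D`. [folklore] -/
-- adapted from Cruxes/EulerHalfNotRamNoInertSetAtFive/Lines/aux_norm_receptacle.lean (bsd-idea-9 g8), verbatim
theorem exists_sum_eq_card_nsmul {H : Type*} [Group H] [Fintype H] (D : Subgroup H)
    {A : Type*} [AddCommMonoid A] (c : H → A) (hc : ∀ h : H, ∀ d ∈ D, c (h * d) = c h) :
    ∃ t : A, ∑ h, c h = Nat.card D • t := by
  classical
  have hfac : ∀ h : H, c h = c (Quotient.out (QuotientGroup.mk (s := D) h)) := by
    intro h
    set q : H ⧸ D := QuotientGroup.mk h with hq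
    have hmem : (Quotient.out q)⁻¹ * h ∈ D := by
      rw [← QuotientGroup.eq, QuotientGroup.out_eq']
    have : h = Quotient.out q * ((Quotient.out q)⁻¹ * h) := by group
    calc c h = c (Quotient.out q * ((Quotient.out q)⁻¹ * h)) := by rw [← this]
      _ = c (Quotient.out q) := hc _ _ hmem
  have hfib : ∀ q : H ⧸ D,
      (Finset.univ.filter (fun h : H => (QuotientGroup.mk (s := D) h) = q)).card = Nat.card D := by
    intro q
    rw [← Fintype.card_subtype, ← Nat.card_eq_fintype_card]
    let f : D → {h : H // (QuotientGroup.mk (s := D) h) = q} := fun d =>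
      ⟨Quotient.out q * d, by
        rw [← QuotientGroup.out_eq' q]
        refine (QuotientGroup.eq.mpr ?_).symm
        · simp⟩
    have hf : Function.Bijective f := by
      constructor
      · intro d d' hdd'
        have := congrArg Subtype.val hdd'
        simp only [f] at this
        exact Subtype.ext (mul_left_cancel this)
      · rintro ⟨h, hh⟩
        have hmem : (Quotient.out q)⁻¹ * h ∈ D := by
          rw [← QuotientGroup.eq, QuotientGroup.out_eq', hh]
        exact ⟨⟨_, hmem⟩, Subtype.ext (by simp [f])⟩
    exact (Nat.card_eq_of_bijective f hf).symm
  refine ⟨∑ q : H ⧸ D, c (Quotient.out q), ?_⟩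
  calc ∑ h, c h = ∑ h, c (Quotient.out (QuotientGroup.mk (s := D) h)) :=
        Finset.sum_congr rfl fun h _ => hfac h
    _ = ∑ q : H ⧸ D, ∑ h ∈ Finset.univ.filter (fun h : H => (QuotientGroup.mk (s := D) h) = q),
          c (Quotient.out q) :=
        (Finset.sum_fiberwise' Finset.univ (fun h : H => (QuotientGroup.mk (s := D) h))
          (fun q => c (Quotient.out q))).symm
    _ = ∑ q : H ⧸ D, Nat.card D • c (Quotient.out q) := by
        refine Finset.sum_congr rfl fun q _ => ?_
        rw [Finset.sum_const, hfib q]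
    _ = Nat.card D • ∑ q : H ⧸ D, c (Quotient.out q) := by rw [Finset.smul_sum]

/-- (A1″) **Orbit counting along a cyclic group, for a stabiliser-invariant function.** For `σ` with `σ ^ n = 1` acting on `X`, a point `x`
and a function `c : G → A` with `c (d * g) = c g` whenever `d ∈ ⟨σ⟩` fixes `x`: `∑_{i<n} c (σ^i)` is a multiple of the order of the
stabiliser of `x` in `⟨σ⟩` (in the application: of the decomposition group of a place, `c g = [g • P] ∈ E(L) ∕ E₀,w`). [folklore] -/
theorem exists_sum_range_eq_card_stabilizer_nsmul_of_invariant {G : Type*} [Group G] {X : Type*} [MulAction G X]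
    {A : Type*} [AddCommMonoid A] (σ : G) {n : ℕ} (hn : σ ^ n = 1) (x : X) (c : G → A)
    (hc : ∀ g d : G, d ∈ Subgroup.zpowers σ → d • x = x → c (d * g) = c g) :
    ∃ t : A, ∑ i ∈ Finset.range n, c (σ ^ i) =
      Nat.card (MulAction.stabilizer (Subgroup.zpowers σ) x) • t := by
  classical
  rcases Nat.eq_zero_or_pos n with rfl | hnpos
  · exact ⟨0, by simp⟩
  have hfin : IsOfFinOrder σ := isOfFinOrder_iff_pow_eq_one.mpr ⟨n, hnpos, hn⟩
  have hd : 0 < orderOf σ := hfin.orderOf_pos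
  have hdn : orderOf σ ∣ n := orderOf_dvd_of_pow_eq_one hn
  -- the summand is `orderOf σ`-periodic
  set f : ℕ → A := fun i => c (σ ^ i) with hfdef
  have hmul : ∀ k : ℕ, ∑ i ∈ Finset.range (orderOf σ * k), f i = k • ∑ i ∈ Finset.range (orderOf σ), f i := by
    intro k
    induction k with
    | zero => simp
    | succ k ih =>
      rw [Nat.mul_succ, Finset.sum_range_add, ih, succ_nsmul]
      congr 1
      refine Finset.sum_congr rfl fun i _ => ?_
      simp only [hfdef, pow_add, pow_mul, pow_orderOf_eq_one, one_pow, one_mul]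
  -- the sum over one period is the sum over the subgroup `⟨σ⟩`
  haveI : Finite (Subgroup.zpowers σ) := Nat.finite_of_card_ne_zero (by rw [Nat.card_zpowers]; exact hd.ne')
  letI : Fintype (Subgroup.zpowers σ) := Fintype.ofFinite _
  have h1 : ∑ i ∈ Finset.range (orderOf σ), f i = ∑ h : Subgroup.zpowers σ, c (h : G) := by
    rw [Finset.sum_range]
    exact Fintype.sum_equiv (finEquivZPowers hfin) _ _ fun i => by
      simp [hfdef, finEquivZPowers_apply]
  obtain ⟨t, ht⟩ := exists_sum_eq_card_nsmul (MulAction.stabilizer (Subgroup.zpowers σ) x)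
    (fun h : Subgroup.zpowers σ => c (h : G)) fun h d hd => by
      rw [MulAction.mem_stabilizer_iff, Subgroup.smul_def] at hd
      show c ((h * d : Subgroup.zpowers σ) : G) = c (h : G)
      obtain ⟨a, ha⟩ := Subgroup.mem_zpowers_iff.mp h.2
      obtain ⟨b, hb⟩ := Subgroup.mem_zpowers_iff.mp d.2
      have hcomm : (h : G) * d = d * h := by rw [← ha, ← hb]; exact zpow_mul_comm σ a b
      rw [Subgroup.coe_mul, hcomm]
      exact hc _ _ d.2 hd
  obtain ⟨k, hk⟩ := hdn
  refine ⟨k • t, ?_⟩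
  rw [hk, hmul k, h1, ht, smul_comm]

/-- (A2) **Bezout in an abelian group killed by `c`.** If `a • x = D • t` with the INTEGER `a` prime to `p`, `p ^ e ∣ D`, `p ^ e ∣ c` and
`c` kills the group, then `(c ∕ p ^ e) • x = 0` (`α a + β p^e = 1`). [folklore] -/
theorem nsmul_ordCompl_eq_zero_of_smul_eq_card_nsmul {A : Type*} [AddCommGroup A] {p e c D : ℕ} {a : ℤ} (hp : p ≠ 0)
    (hap : IsCoprime a (p : ℤ)) (hc : p ^ e ∣ c) (hD : p ^ e ∣ D) (hkill : ∀ y : A, c • y = 0) {x t : A}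
    (h : a • x = D • t) : (c / p ^ e) • x = 0 := by
  obtain ⟨α, β, hαβ⟩ := hap.pow_right (n := e)
  obtain ⟨k, rfl⟩ := hD
  obtain ⟨c', rfl⟩ := hc
  rw [Nat.mul_div_cancel_left c' (Nat.pos_of_ne_zero (pow_ne_zero e hp))]
  -- `x = p^e • z`
  set z : A := (α * k) • t + β • x with hz
  have hxz : x = ((p : ℤ) ^ e) • z := by
    calc x = (α * a + β * (p : ℤ) ^ e) • x := by rw [hαβ, one_smul]
      _ = α • (a • x) + (p : ℤ) ^ e • (β • x) := by rw [add_smul, mul_smul, mul_comm β, mul_smul]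
      _ = α • (((p ^ e * k : ℕ) : ℤ) • t) + (p : ℤ) ^ e • (β • x) := by rw [h, natCast_zsmul]
      _ = (p : ℤ) ^ e • ((α * k) • t) + (p : ℤ) ^ e • (β • x) := by
          congr 1
          rw [smul_smul, smul_smul]
          congr 1
          push_cast
          ring
      _ = (p : ℤ) ^ e • z := by rw [hz, smul_add]
  calc c' • x = (c' : ℤ) • x := (natCast_zsmul x c').symm
    _ = ((c' : ℤ) * (p : ℤ) ^ e) • z := by rw [hxz, smul_smul]
    _ = ((p ^ e * c' : ℕ) : ℤ) • z := by
        congr 1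
        push_cast
        ring
    _ = (p ^ e * c') • z := natCast_zsmul z _
    _ = 0 := hkill z

/-! ### §1 Descent of `E₀` along a `ℚ`-algebra map of number fields -/

/-- **Descent of nonsingular reduction along a field map.** For `W/ℚ` with integer coefficients, number fields `L₁, L₂`, a `ℚ`-algebra
map `f : L₁ → L₂`, a prime `q` and a point `P ∈ E(L₁)`: if `f P` has nonsingular reduction (on `W`) at EVERY finite place of `L₂`
containing `q`, then `P` has nonsingular reduction at every finite place of `L₁` containing `q` (every such place `w₁` has a place `w₂`
of `L₂` over it — going up for `𝓞 L₂ ∕ 𝓞 L₁` — whose valuation restricts to a power of that of `w₁` (Mathlib `valuation_liesOver`), and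
`E₀` for a fixed equation is invariant under such valued-field maps: the tree's `hasNonsingularReduction_some_iff_of_ringHom`).
[cite: NeukirchANT1999, Ch. II (8.1)–(8.2)] [cite: SilvermanAEC2009, VII §2 (definition of E₀)] -/
theorem hasNonsingularReduction_of_forall_place_map (W : WeierstrassCurve ℚ) [W.IsIntegral ℤ]
    {L₁ L₂ : Type} [Field L₁] [NumberField L₁] [Field L₂] [NumberField L₂] (f : L₁ →ₐ[ℚ] L₂) (q : ℕ)
    (P : (W.baseChange L₁).toAffine.Point)
    (h : ∀ w₂ : HeightOneSpectrum (𝓞 L₂), ((q : ℕ) : 𝓞 L₂) ∈ w₂.asIdeal →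
      (placeIntModel W L₂ w₂).HasNonsingularReduction (K := L₂) (Affine.Point.map (W' := W) f P))
    (w₁ : HeightOneSpectrum (𝓞 L₁)) (hw₁ : ((q : ℕ) : 𝓞 L₁) ∈ w₁.asIdeal) :
    (placeIntModel W L₁ w₁).HasNonsingularReduction (K := L₁) P := by
  letI : Algebra L₁ L₂ := f.toRingHom.toAlgebra
  have hfalg : ∀ x : L₁, algebraMap L₁ L₂ x = f x := fun _ ↦ rfl
  -- a place `w₂` of `L₂` over `w₁`
  haveI : w₁.asIdeal.IsMaximal := w₁.isMaximal
  obtain ⟨Q, hQmax, hQ⟩ := Ideal.exists_ideal_over_maximal_of_isIntegral (S := 𝓞 L₂) w₁.asIdeal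
    (by rw [RingOfIntegers.ker_algebraMap_eq_bot]; exact bot_le)
  have hQne : Q ≠ ⊥ := by
    rintro rfl
    refine w₁.ne_bot ?_
    rw [← hQ]
    exact Ideal.comap_bot_of_injective _ (RingOfIntegers.algebraMap.injective L₁ L₂)
  let w₂ : HeightOneSpectrum (𝓞 L₂) := ⟨Q, hQmax.isPrime, hQne⟩
  haveI : w₂.asIdeal.LiesOver w₁.asIdeal := ⟨by rw [Ideal.under_def]; exact hQ.symm⟩
  have hqw₂ : ((q : ℕ) : 𝓞 L₂) ∈ w₂.asIdeal := by
    have := (Ideal.mem_of_liesOver w₂.asIdeal w₁.asIdeal ((q : ℕ) : 𝓞 L₁)).mp hw₁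
    simpa using this
  -- valuation compatibility
  have he : w₁.asIdeal.ramificationIdx' w₂.asIdeal ≠ 0 :=
    Ideal.IsDedekindDomain.ramificationIdx'_ne_zero_of_liesOver w₂.asIdeal w₁.ne_bot
  have hf : ∀ z : L₁, w₁.valuation L₁ z ≤ 1 ↔ w₂.valuation L₂ (f z) ≤ 1 := by
    intro z
    rw [← hfalg, ← IsDedekindDomain.HeightOneSpectrum.valuation_liesOver L₂ w₁ w₂ z]
    constructor
    · exact fun hz ↦ pow_le_one₀ zero_le hz
    · intro hz
      by_contra hlt
      exact (lt_irrefl (1 : WithZero (Multiplicative ℤ))) (lt_of_lt_of_le (one_lt_pow₀ (not_le.mp hlt) he) hz)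
  -- the point
  rcases P with _ | ⟨x, y, hxy⟩
  · exact WeierstrassCurve.hasNonsingularReduction_zero (K := L₁) (W := placeIntModel W L₁ w₁)
  · have h₂ : (W.baseChange L₂).toAffine.Nonsingular (f x) (f y) :=
      (Affine.baseChange_nonsingular W f.injective x y).mpr hxy
    have hmap : Affine.Point.map (W' := W) f (.some x y hxy) = .some _ _ h₂ := by
      rw [Affine.Point.map_some]
    have key := h w₂ hqw₂
    rw [hmap] at key
    -- the restriction of `f` to the valuation rings
    let φ : (w₁.valuation L₁).valuationSubring →+* (w₂.valuation L₂).valuationSubring :=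
      { toFun := fun a ↦ ⟨f (a : L₁), (Valuation.mem_valuationSubring_iff _ _).mpr
          ((hf (a : L₁)).mp ((Valuation.mem_valuationSubring_iff _ _).mp a.2))⟩
        map_one' := Subtype.ext (map_one f)
        map_mul' := fun a b ↦ Subtype.ext (map_mul f (a : L₁) (b : L₁))
        map_zero' := Subtype.ext (map_zero f)
        map_add' := fun a b ↦ Subtype.ext (map_add f (a : L₁) (b : L₁)) }
    have hφ : ∀ a, algebraMap (w₂.valuation L₂).valuationSubring L₂ (φ a) =
        (f : L₁ →+* L₂) (algebraMap (w₁.valuation L₁).valuationSubring L₁ a) := fun _ ↦ rfl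
    have hc : ∀ r : ℚ, f (algebraMap ℚ L₁ r) = algebraMap ℚ L₂ r := fun r ↦ f.commutes r
    have hW : (placeIntModel W L₁ w₁).map φ = placeIntModel W L₂ w₂ := by
      ext
      · exact hc W.a₁
      · exact hc W.a₂
      · exact hc W.a₃
      · exact hc W.a₄
      · exact hc W.a₆
    exact (hasNonsingularReduction_some_iff_of_ringHom (valuation_integers_valuationSubring _)
      (valuation_integers_valuationSubring _) (f : L₁ →+* L₂) φ hφ hf hW hxy h₂).mp key

end Summit.BirchSwinnertonDyer.BirchSwinnertonDyer.Theorems.ShimuraWalk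

end
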